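import Mathlib
import Literature.Combinatorics.Optimization.BlockPsdLiftFactorization
import HarnessLib

/-!
# The DIMENSION RUNG for `COR(n) + Q` — DEFINITIONS (val-idea-40's `DimensionRung.lean`, crux `Theses.FifoMatching.NNDivisionHard`,
# stmt-ValiantsHypothesis-21181; class D of line `virtual_passenger`)

Theorems-side port, definition lane (port hand val-port-1 g3; desk RULING #331 «LowDim PORT», critic of record val-idea-crit-9 g0 VETO-note
19:10:13Z (1) / VERDICT #8; `--supports stmt-ValiantsHypothesis-21181 --as helper`) of the OBJECTS of
`Cruxes/NNDivisionHard/DimensionRung.lean` (rev 4 @a45b7939cb12, val-idea-40 g0; sha16 e492007789666bf5) §2/§4/§5 and of the FMPTW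
witnesses of `Cruxes/NNLinearDegreeCofactorHard/Lines/xc_division.lean` §3/§5 (val-idea-7; critic val-idea-crit-3 g3 PASS) that the rung's
lemmas mention BY NAME — texts VERBATIM, namespaces moved `…Cruxes…XcDivision` ↦ `…Theorems.FifoMatching.XcDivision` and
`…Cruxes.NNDivisionHard.ValIdea40.Flat` ↦ `…Theorems.FifoMatching.LowDim` (crux workfiles are not importable from `Theorems/`):

* `XcDivision.udInd a = 𝟙_a`, `udPt b = 𝟙_b 𝟙_bᵀ ∈ COR(n)`, `udMat a = 2 diag(𝟙_a) − 𝟙_a 𝟙_aᵀ`, `udRow a = flat (udMat a)` (the FMPTW /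
  clique rows, [cite: FioriniEtAl2015, §4.1 eq. (4), Lemma 6]) and the signed diagonal direction `diagDir S S' = E_S − E_{S'}`;
* `LowDim.ent n p q` (the coordinate functional `X ↦ X_{pq}`, flattened), `LowDim.psi S S'` (the TEST FAMILY of the coordinate face
  `F_{S,S'}`: entries on `(S ∪ S')²`, row couplings `X_{pk} − X_{kk}` / `X_{pk}` for free `k`), `LowDim.faceKer A` (the solution space of
  the face equations of `F_{A,∅}`), `LowDim.adim S` (affine dimension = rank of the direction space).

The theorems (EXPOSURE RUNG, FLAG LEMMA, ★ DIMENSION RUNG `corPolytopeGraph_top_add_hull_three_pow_le_of_finrank`, the transport with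
dimension and ★ `corMinkowskiHard_lowdim` / ★ `nnDivisionHard_lowdim`) are the sibling files `…NNDivisionHardLowDim{Rung,Flag,Rate}.lean`.
HONEST FRAMING: definitions only; class D is a restriction of COR-VIRTUAL; stmt-21181 `NNDivisionHard` OPEN; COR-MINKOWSKI OPEN;
`VP ≠ VNP` NOT proved; nothing here is a summit statement.
-/

set_option autoImplicit false

-- the mandated summit-side namespace repeats a component by design (single-problem summit)
set_option linter.dupNamespace false

noncomputable section

open Matrix Finset

namespace Summit.ValiantsHypothesis.ValiantsHypothesis.Theorems.FifoMatching

/-! ## FMPTW witnesses of `COR(n)` (xc_division §3) and the signed diagonal direction (§5) -/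

namespace XcDivision

open Literature.Combinatorics.Optimization.FixedSizePsdRank (vecOuter bvec flat)

/-- indicator vector `𝟙_a` of a subset (as `bvec`) -/
def udInd {n : ℕ} (a : Finset (Fin n)) : Fin n → ℝ := bvec fun i => decide (i ∈ a)

/-- the vertex `𝟙_b 𝟙_bᵀ` of `COR(n)` -/
def udPt {n : ℕ} (b : Finset (Fin n)) : Fin (n * n) → ℝ := vecOuter n (udInd b)

/-- the FMPTW / clique matrix `2 diag(𝟙_a) - 𝟙_a 𝟙_aᵀ` -/
def udMat {n : ℕ} (a : Finset (Fin n)) : Matrix (Fin n) (Fin n) ℝ := fun i j =>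
  2 * (if i = j then 1 else 0) * udInd a i - udInd a i * udInd a j

/-- the FMPTW row functional `x ↦ ⟨2 diag(𝟙_a) - 𝟙_a 𝟙_aᵀ, x⟩` (valid: `≤ 1` on `COR(n)`) -/
def udRow {n : ℕ} (a : Finset (Fin n)) : Fin (n * n) → ℝ := flat (udMat a)

/-- the signed diagonal direction `E_S - E_{S'}` of `ℝ^{n×n}` (flattened): it exposes the face
`{bbᵀ : S ⊆ b, b ∩ S' = ∅} ≅ COR(n - |S| - |S'|)` of `COR(n)`. -/
def diagDir {n : ℕ} (S S' : Finset (Fin n)) : Fin (n * n) → ℝ :=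
  flat (Matrix.diagonal fun i => if i ∈ S then (1 : ℝ) else if i ∈ S' then -1 else 0)

end XcDivision

/-! ## Objects of the exposure / flag / dimension rungs (DimensionRung §2, §4, §5) -/

namespace LowDim

open Literature.Combinatorics.Optimization.FixedSizePsdRank (flat)

/-- the coordinate functional `X ↦ X_{pq}` (flattened). -/
def ent (n : ℕ) (p q : Fin n) : Fin (n * n) → ℝ :=
  flat (fun i j => if i = p ∧ j = q then (1 : ℝ) else 0)

/-- the TEST FAMILY of the face `F_{S,S'}`: entries on `(S ∪ S')²`; for a free index `k`, the row couplings
`X_{pk} - X_{kk}` (`p ∈ S`) and `X_{pk}` (`p ∈ S'`).  Each is CONSTANT on the vertices of the face. -/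
def psi {n : ℕ} (S S' : Finset (Fin n)) : Bool × Fin n × Fin n → (Fin (n * n) → ℝ)
  | (false, p, q) => if p ∈ S ∪ S' ∧ q ∈ S ∪ S' then ent n p q else 0
  | (true, p, k) => if k ∈ S ∪ S' then 0 else
      if p ∈ S then ent n p k - ent n k k else if p ∈ S' then ent n p k else 0

/-- the solution space of the face equations of `F_{A,∅}`: `K_A := {x | ψ_t · x = 0 for every test t of (A, ∅)}`. -/
def faceKer {n : ℕ} (A : Finset (Fin n)) : Submodule ℝ (Fin (n * n) → ℝ) where
  carrier := {x | ∀ t, psi A ∅ t ⬝ᵥ x = 0}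
  add_mem' := by
    intro x y hx hy t
    show psi A ∅ t ⬝ᵥ (x + y) = 0
    rw [dotProduct_add, hx t, hy t, add_zero]
  zero_mem' := by
    intro t
    show psi A ∅ t ⬝ᵥ 0 = 0
    rw [dotProduct_zero]
  smul_mem' := by
    intro c x hx t
    show psi A ∅ t ⬝ᵥ (c • x) = 0
    rw [dotProduct_smul, hx t, smul_zero]

/-- the affine dimension of a point set, as the rank of its direction space. -/
abbrev adim {ι : Type} (S : Set (ι → ℝ)) : ℕ := Module.finrank ℝ ↥(vectorSpan ℝ S)

end LowDim

end Summit.ValiantsHypothesis.ValiantsHypothesis.Theorems.FifoMatching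

end
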